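import Summits.Ventures.QEC.Census.CertBZInfoSets
import Summits.Ventures.QEC.Census.BB.BB144.BZAutData
import HarnessLib

/-!
# `BB144` — `bz` certificate, side Z: relative-rank BOUNDS per block, tier KERNEL (item S7.BZI; qec-search-7)

For each block `b`: `cert.bzZBound bzAutData b = true` by `decide +kernel` — the Brouwer–Zimmermann bound
`Σ_i (t_i + 1 − (k_b − relRank_i))`, with the relative ranks RECOUNTED from the information-set masks
(`bzBoundList`), reaches `wEff + 1` (CERT-FORMAT C3 / C17 (6); the `hbound` input of `BZAssembly.forall_lt_of_bz`).
-/

namespace Summit.Ventures.QEC.Census.BB144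

/-- Block 0: bound 11 ≥ target (kernel). -/
theorem autBoundZ_0 : cert.bzZBound bzAutData 0 = true := by decide +kernel

/-- Block 1: bound 11 ≥ target (kernel). -/
theorem autBoundZ_1 : cert.bzZBound bzAutData 1 = true := by decide +kernel

/-- Block 2: bound 11 ≥ target (kernel). -/
theorem autBoundZ_2 : cert.bzZBound bzAutData 2 = true := by decide +kernel

/-- Block 3: bound 11 ≥ target (kernel). -/
theorem autBoundZ_3 : cert.bzZBound bzAutData 3 = true := by decide +kernel

/-- Block 4: bound 11 ≥ target (kernel). -/
theorem autBoundZ_4 : cert.bzZBound bzAutData 4 = true := by decide +kernel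

/-- Block 5: bound 11 ≥ target (kernel). -/
theorem autBoundZ_5 : cert.bzZBound bzAutData 5 = true := by decide +kernel

/-- Block 6: bound 11 ≥ target (kernel). -/
theorem autBoundZ_6 : cert.bzZBound bzAutData 6 = true := by decide +kernel

/-- Block 7: bound 11 ≥ target (kernel). -/
theorem autBoundZ_7 : cert.bzZBound bzAutData 7 = true := by decide +kernel

/-- Block 8: bound 11 ≥ target (kernel). -/
theorem autBoundZ_8 : cert.bzZBound bzAutData 8 = true := by decide +kernel

/-- Block 9: bound 11 ≥ target (kernel). -/
theorem autBoundZ_9 : cert.bzZBound bzAutData 9 = true := by decide +kernel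

/-- Block 10: bound 11 ≥ target (kernel). -/
theorem autBoundZ_10 : cert.bzZBound bzAutData 10 = true := by decide +kernel

/-- Block 11: bound 11 ≥ target (kernel). -/
theorem autBoundZ_11 : cert.bzZBound bzAutData 11 = true := by decide +kernel

/-- Block 12: bound 11 ≥ target (kernel). -/
theorem autBoundZ_12 : cert.bzZBound bzAutData 12 = true := by decide +kernel

/-- Block 13: bound 11 ≥ target (kernel). -/
theorem autBoundZ_13 : cert.bzZBound bzAutData 13 = true := by decide +kernel

/-- Block 14: bound 11 ≥ target (kernel). -/
theorem autBoundZ_14 : cert.bzZBound bzAutData 14 = true := by decide +kernel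

end Summit.Ventures.QEC.Census.BB144
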